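import Summits.CriticalPhenomena.CardyFormulaZ2.Theses.CardyQContinuation
import Summits.CriticalPhenomena.CardyFormulaZ2.Theorems.CardyQContinuationIsingJetsConformalStubIsingCrossingConformalNormalisation
import Literature.Probability.LatticeModels.FKIsingQuadrilateralCrossing
import Literature.Probability.LatticeModels.FKTwoArcPartitionPolynomials

/-!
# Normal forms of the loop-symmetric FK-Ising crossing ratio
(route CardyQContinuation, serves stmt-CriticalPhenomena-5560, registered stub
`stub_loopSymmetricLimit_normalForms` of the n = 0 bridge of the crux `IsingJetsConformal`)

The `n = 0` case of the crux compares the critical FK-Ising (`q = 2`, self-dual point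
`p = √2/(1+√2)`) crossing probability of the tree's discretisation `Ω_δ` of a conformal rectangle
`R`, in the LOOP-SYMMETRIC normalisation
`LS_δ = N_δ(√2) / (N_δ(√2) + √2 (Z^joint_δ(√2) - N_δ(√2)))`
(`N_δ = aeval √2 (fkTwoArcCrossingPolynomial R δ joint)`,
`Z^joint_δ = aeval √2 (fkTwoArcPartitionPolynomials R δ joint)`), with the Chelkak–Smirnov
discrete quadrilaterals, whose crossing probability `DiscreteRect.csCrossingProb E d₀ n` is the
same expression over `rcArcPolynomialIn (graph E) (arcCrossing B₀ B₂) B₀ B₂ joint` and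
`rcArcPolynomial (graph E) B₀ B₂ joint` (Chelkak–Smirnov 2012, §6, `P^δ`). All comparison lemmas
(FKG, monotonicity in the domain) are stated for probabilities `(μ).real A` of increasing events
under the random-cluster measures `fkDomainMeasure` / `rcMeasure` of `RandomCluster.lean`, so one
needs the NORMAL FORMS proved here (`stub_loopSymmetricLimit_normalForms`):

* `LS_δ = f (P_δ)` with `f s = s / (s + √2 (1 - s))` and
  `P_δ = φ^{(ab)∪(cd)}_{Ω_δ, √2/(1+√2), 2}(C_δ) = N_δ / Z^joint_δ`
  (`measureReal_fkDomainMeasure_discreteCrossing`);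
* `csCrossingProb E d₀ n = f (P)` with `P = φ^{B₀ ∪ B₂}_{⟨E⟩, √2/(1+√2), 2}(B₀ ↔ B₂) = N / Z`
  (`measureReal_rcMeasure_selfDual`), for ANY `DecidableRel (graph E).Adj` instance;
* `f` is strictly increasing on `[0, 1]` (`f s = s / (√2 - (√2 - 1) s)`, denominator `≥ 1`), so
  that inequalities between crossing probabilities transfer to the loop-symmetric ratios.

The only algebra is the Möbius identity `N / (N + √2 (Z - N)) = f (N / Z)` for `Z ≠ 0`
(`LoopSymmetricNormalForms.loopSymmetric_eq_normalForm_div`).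

References: D. Chelkak, S. Smirnov, Invent. Math. 189 (2012), §6, Thm 6.1; G. Grimmett, *The
Random-Cluster Model* (2006), §6.1 eq. (6.9).
-/

namespace Summit.CriticalPhenomena.CardyFormulaZ2.Theorems.CardyQContinuation

open Set Polynomial
open scoped Polynomial
open Literature.Probability.LatticeModels Literature.Probability.Percolation
open Literature.Probability.RandomPlanarGeometry

noncomputable section

namespace LoopSymmetricNormalForms

/-- **The Möbius identity behind the normal forms**: for `Z ≠ 0`,
`N / (N + √2 (Z - N)) = (N/Z) / ((N/Z) + √2 (1 - N/Z))` (divide numerator and denominator by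
`Z`; both sides are `0` when `N + √2 (Z - N) = 0`). -/
theorem loopSymmetric_eq_normalForm_div {N Z : ℝ} (hZ : Z ≠ 0) :
    N / (N + Real.sqrt 2 * (Z - N)) = N / Z / (N / Z + Real.sqrt 2 * (1 - N / Z)) := by
  have h : N / Z + Real.sqrt 2 * (1 - N / Z) = (N + Real.sqrt 2 * (Z - N)) / Z := by
    field_simp
  rw [h, div_div_div_cancel_right₀ hZ]

/-- The denominator of `f s = s / (s + √2 (1 - s))` is at least `1` on `[0, 1]`
(`s + √2 (1 - s) = √2 - (√2 - 1) s ≥ √2 - (√2 - 1) = 1`). -/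
theorem one_le_add_sqrt_two_mul_one_sub {s : ℝ} (hs : s ∈ Icc (0 : ℝ) 1) :
    1 ≤ s + Real.sqrt 2 * (1 - s) := by
  have h2 : (1 : ℝ) < Real.sqrt 2 := Real.one_lt_sqrt_two
  nlinarith [hs.1, hs.2, h2]

/-- **Strict monotonicity of the Möbius normal form** `f s = s / (s + √2 (1 - s))` on `[0, 1]`:
for `0 ≤ s < s' ≤ 1`, cross-multiplying the positive denominators reduces `f s < f s'` to
`√2 s < √2 s'`. -/
theorem strictMonoOn_normalForm :
    StrictMonoOn (fun s : ℝ ↦ s / (s + Real.sqrt 2 * (1 - s))) (Icc (0 : ℝ) 1) := by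
  intro s hs s' hs' hss'
  have hd : 0 < s + Real.sqrt 2 * (1 - s) :=
    one_pos.trans_le (one_le_add_sqrt_two_mul_one_sub hs)
  have hd' : 0 < s' + Real.sqrt 2 * (1 - s') :=
    one_pos.trans_le (one_le_add_sqrt_two_mul_one_sub hs')
  simp only
  rw [div_lt_div_iff₀ hd hd']
  nlinarith [mul_lt_mul_of_pos_left hss' (Real.sqrt_pos.2 (two_pos : (0 : ℝ) < 2))]

/-- **Normal form on the tree's discretisation of a conformal rectangle**: for `δ > 0` (and any
`Fintype` instance on the vertex set of `Ω_δ`), the loop-symmetric ratio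
`N_δ(√2) / (N_δ(√2) + √2 (Z^joint_δ(√2) - N_δ(√2)))` is `f` of the self-dual crossing
probability `φ^{(ab)∪(cd)}_{Ω_δ, √2/(1+√2), 2}(C_δ) = N_δ(√2) / Z^joint_δ(√2)`
(`measureReal_fkDomainMeasure_discreteCrossing`, `Z^joint_δ(√2) > 0`). -/
theorem loopSymmetric_fkTwoArc_eq_normalForm (R : ConformalRectangle) {δ : ℝ} (hδ : 0 < δ)
    [Fintype (meshDomain R.carrier δ)] :
    aeval (Real.sqrt 2) (fkTwoArcCrossingPolynomial R δ ArcWiring.joint) /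
        (aeval (Real.sqrt 2) (fkTwoArcCrossingPolynomial R δ ArcWiring.joint) +
          Real.sqrt 2 * (aeval (Real.sqrt 2) (fkTwoArcPartitionPolynomials R δ ArcWiring.joint) -
            aeval (Real.sqrt 2) (fkTwoArcCrossingPolynomial R δ ArcWiring.joint))) =
      (fkDomainMeasure R.carrier δ (Real.sqrt 2 / (1 + Real.sqrt 2)) (Real.sqrt 2 ^ 2)
            (R.arc 0 ∪ R.arc 2)).real (discreteCrossing R.carrier δ (R.arc 0) (R.arc 2)) /
        ((fkDomainMeasure R.carrier δ (Real.sqrt 2 / (1 + Real.sqrt 2)) (Real.sqrt 2 ^ 2)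
              (R.arc 0 ∪ R.arc 2)).real (discreteCrossing R.carrier δ (R.arc 0) (R.arc 2)) +
          Real.sqrt 2 * (1 - (fkDomainMeasure R.carrier δ (Real.sqrt 2 / (1 + Real.sqrt 2))
              (Real.sqrt 2 ^ 2) (R.arc 0 ∪ R.arc 2)).real
                (discreteCrossing R.carrier δ (R.arc 0) (R.arc 2)))) := by
  have ht : (0 : ℝ) < Real.sqrt 2 := Real.sqrt_pos.2 two_pos
  rw [measureReal_fkDomainMeasure_discreteCrossing R hδ ht]
  exact loopSymmetric_eq_normalForm_div (aeval_fkTwoArcPartitionPolynomials_pos R hδ ht _).ne'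

/-- `Z^joint_G(t) > 0` for `t > 0` on any finite graph (the empty configuration contributes a
positive power of `t`, all terms are nonnegative). -/
theorem aeval_rcArcPolynomial_pos {V : Type*} [Fintype V] (G : SimpleGraph V)
    [DecidableRel G.Adj] {t : ℝ} (ht : 0 < t) (B₁ B₂ : Set V) (w : ArcWiring) :
    0 < aeval t (rcArcPolynomial G B₁ B₂ w) := by
  rw [aeval_rcArcPolynomial]
  exact Finset.sum_pos (fun _ _ => pow_pos ht _) ⟨∅, Finset.empty_mem_powerset _⟩

/-- **Normal form for the Chelkak–Smirnov discrete quadrilaterals**: the loop-measure crossing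
probability `csCrossingProb E d₀ n = N / (N + √2 (Z - N))` (Chelkak–Smirnov 2012, §6, `P^δ`) is
`f` of the self-dual random-cluster probability
`φ^{B₀ ∪ B₂}_{⟨E⟩, √2/(1+√2), 2}(B₀ ↔ B₂) = N / Z` (`measureReal_rcMeasure_selfDual`), for any
`DecidableRel (graph E).Adj` instance (the polynomials do not depend on it). -/
theorem csCrossingProb_eq_normalForm (E : Finset (Sym2 (Site 2))) (d₀ : Site 2 × Fin 4)
    (n : Fin 4 → ℕ) [DecidableRel (DiscreteRect.graph E).Adj] :
    DiscreteRect.csCrossingProb E d₀ n =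
      (rcMeasure (DiscreteRect.graph E) (Real.sqrt 2 / (1 + Real.sqrt 2)) (Real.sqrt 2 ^ 2)
            ({x | x.1 ∈ DiscreteRect.blackVerts E d₀ n 0} ∪
              {x | x.1 ∈ DiscreteRect.blackVerts E d₀ n 2})).real
          (arcCrossing {x | x.1 ∈ DiscreteRect.blackVerts E d₀ n 0}
            {x | x.1 ∈ DiscreteRect.blackVerts E d₀ n 2}) /
        ((rcMeasure (DiscreteRect.graph E) (Real.sqrt 2 / (1 + Real.sqrt 2)) (Real.sqrt 2 ^ 2)
              ({x | x.1 ∈ DiscreteRect.blackVerts E d₀ n 0} ∪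
                {x | x.1 ∈ DiscreteRect.blackVerts E d₀ n 2})).real
            (arcCrossing {x | x.1 ∈ DiscreteRect.blackVerts E d₀ n 0}
              {x | x.1 ∈ DiscreteRect.blackVerts E d₀ n 2}) +
          Real.sqrt 2 * (1 - (rcMeasure (DiscreteRect.graph E) (Real.sqrt 2 / (1 + Real.sqrt 2))
              (Real.sqrt 2 ^ 2) ({x | x.1 ∈ DiscreteRect.blackVerts E d₀ n 0} ∪
                {x | x.1 ∈ DiscreteRect.blackVerts E d₀ n 2})).real
            (arcCrossing {x | x.1 ∈ DiscreteRect.blackVerts E d₀ n 0}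
              {x | x.1 ∈ DiscreteRect.blackVerts E d₀ n 2}))) := by
  have ht : (0 : ℝ) < Real.sqrt 2 := Real.sqrt_pos.2 two_pos
  rw [measureReal_rcMeasure_selfDual _ ht, ← loopSymmetric_eq_normalForm_div
    (aeval_rcArcPolynomial_pos _ ht _ _ _).ne']
  unfold DiscreteRect.csCrossingProb
  congr!

end LoopSymmetricNormalForms

open LoopSymmetricNormalForms in
/-- **Registered stub `stub_loopSymmetricLimit_normalForms`** of the n = 0 bridge of the crux
`IsingJetsConformal` (stmt-CriticalPhenomena-5560): (1) on the tree's discretisation of a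
conformal rectangle the loop-symmetric ratio `N_δ/(N_δ + √2 (Z^joint_δ - N_δ))` at `√2` is
`f (P_δ)`, `f s = s / (s + √2 (1 - s))`, `P_δ` the self-dual `fkDomainMeasure`-probability of
Smirnov's crossing event; (2) the Chelkak–Smirnov loop-measure crossing probability
`csCrossingProb E d₀ n` is `f` of the self-dual `rcMeasure`-probability of the crossing event
`B₀ ↔ B₂`; (3) `f` is strictly increasing on `[0, 1]`. -/
theorem stub_loopSymmetricLimit_normalForms : ((∀ (R : Literature.Probability.RandomPlanarGeometry.ConformalRectangle) (δ : ℝ), 0 < δ → ∀ [Fintype (Literature.Probability.LatticeModels.meshDomain R.carrier δ)], Polynomial.aeval (Real.sqrt 2) (Literature.Probability.LatticeModels.fkTwoArcCrossingPolynomial R δ Literature.Probability.LatticeModels.ArcWiring.joint) / (Polynomial.aeval (Real.sqrt 2) (Literature.Probability.LatticeModels.fkTwoArcCrossingPolynomial R δ Literature.Probability.LatticeModels.ArcWiring.joint) + Real.sqrt 2 * (Polynomial.aeval (Real.sqrt 2) (Literature.Probability.LatticeModels.fkTwoArcPartitionPolynomials R δ Literature.Probability.LatticeModels.ArcWiring.joint)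 - Polynomial.aeval (Real.sqrt 2) (Literature.Probability.LatticeModels.fkTwoArcCrossingPolynomial R δ Literature.Probability.LatticeModels.ArcWiring.joint))) = (Literature.Probability.LatticeModels.fkDomainMeasure R.carrier δ (Real.sqrt 2 / (1 + Real.sqrt 2)) (Real.sqrt 2 ^ 2) (R.arc 0 ∪ R.arc 2)).real (Literature.Probability.Percolation.discreteCrossing R.carrier δ (R.arc 0) (R.arc 2)) / ((Literature.Probability.LatticeModels.fkDomainMeasure R.carrier δ (Real.sqrt 2 / (1 + Real.sqrt 2)) (Real.sqrt 2 ^ 2) (R.arc 0 ∪ R.arc 2)).real (Literature.Probability.Percolation.discreteCrossing R.carrier δ (R.arc 0) (R.arc 2)) + Real.sqrt 2 * (1 - (Literature.Probability.LatticeModels.fkDomainMeasure R.carrier δ (Real.sqrt 2 / (1 + Real.sqrt 2)) (Real.sqrt 2 ^ 2) (R.arc 0 ∪ R.arc 2)).real (Literature.Probability.Percolation.discreteCrossing R.carrier δ (R.arc 0) (R.arc 2))))) ∧ (∀ (E : Finset (Sym2 (Literature.Probability.LatticeModels.Site 2))) (d₀ : Literature.Probability.LatticeModels.Site 2 × Fin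 4) (n : Fin 4 → ℕ) [DecidableRel (Literature.Probability.LatticeModels.DiscreteRect.graph E).Adj], Literature.Probability.LatticeModels.DiscreteRect.csCrossingProb E d₀ n = (Literature.Probability.LatticeModels.rcMeasure (Literature.Probability.LatticeModels.DiscreteRect.graph E) (Real.sqrt 2 / (1 + Real.sqrt 2)) (Real.sqrt 2 ^ 2) ({x | x.1 ∈ Literature.Probability.LatticeModels.DiscreteRect.blackVerts E d₀ n 0} ∪ {x | x.1 ∈ Literature.Probability.LatticeModels.DiscreteRect.blackVerts E d₀ n 2})).real (Literature.Probability.LatticeModels.arcCrossing {x | x.1 ∈ Literature.Probability.LatticeModels.DiscreteRect.blackVerts E d₀ n 0} {x | x.1 ∈ Literature.Probability.LatticeModels.DiscreteRect.blackVerts E d₀ n 2}) / ((Literature.Probability.LatticeModels.rcMeasure (Literature.Probability.LatticeModels.DiscreteRect.graph E) (Real.sqrt 2 / (1 + Real.sqrt 2)) (Real.sqrt 2 ^ 2) ({x | x.1 ∈ Literature.Probability.LatticeModels.DiscreteRect.blackVerts E d₀ n 0} ∪ {x | x.1 ∈ Literature.Probability.LatticeModels.DiscreteRect.blackVerts E d₀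 n 2})).real (Literature.Probability.LatticeModels.arcCrossing {x | x.1 ∈ Literature.Probability.LatticeModels.DiscreteRect.blackVerts E d₀ n 0} {x | x.1 ∈ Literature.Probability.LatticeModels.DiscreteRect.blackVerts E d₀ n 2}) + Real.sqrt 2 * (1 - (Literature.Probability.LatticeModels.rcMeasure (Literature.Probability.LatticeModels.DiscreteRect.graph E) (Real.sqrt 2 / (1 + Real.sqrt 2)) (Real.sqrt 2 ^ 2) ({x | x.1 ∈ Literature.Probability.LatticeModels.DiscreteRect.blackVerts E d₀ n 0} ∪ {x | x.1 ∈ Literature.Probability.LatticeModels.DiscreteRect.blackVerts E d₀ n 2})).real (Literature.Probability.LatticeModels.arcCrossing {x | x.1 ∈ Literature.Probability.LatticeModels.DiscreteRect.blackVerts E d₀ n 0} {x | x.1 ∈ Literature.Probability.LatticeModels.DiscreteRect.blackVerts E d₀ n 2})))) ∧ StrictMonoOn (fun s : ℝ ↦ s / (s + Real.sqrt 2 * (1 - s))) (Set.Icc (0 : ℝ) 1)) := by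
  refine ⟨fun R δ hδ _ => loopSymmetric_fkTwoArc_eq_normalForm R hδ, fun E d₀ n _ => ?_,
    strictMonoOn_normalForm⟩
  exact csCrossingProb_eq_normalForm E d₀ n

end

end Summit.CriticalPhenomena.CardyFormulaZ2.Theorems.CardyQContinuation
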